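import Summits.NavierStokesRegularity.NavierStokesRegularity.Theorems.AdaptedFrequencyAdaptedKernelExistsKernelLimitPairing
import Summits.NavierStokesRegularity.NavierStokesRegularity.Theorems.AdaptedFrequencyAdaptedKernelExistsPrekernelBridge
import Literature.Analysis.FluidPDE.DriftHeatInteriorLipschitz

/-!
# Crux `AdaptedFrequencyConverges` (stmt-NavierStokesRegularity-10493), line
  `cloud-frame-effective-tsai`: EQUICONTINUITY tools for the limit in STUB `stub_blockSolver`

Helper file (lands `--supports stmt-NavierStokesRegularity-10493`).  The block solver is the
limit of classical solutions `G` of `∂ₜG + b·∇G + νΔG = 0` on an open slab `Ioo tₘ T × E`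
(drifts cut off near `T`); the extraction (`kernelLimit_extract` of crux `AdaptedKernelExists`)
needs equicontinuity in time of the pairings `t ↦ ∫ ψ G(t)` and a spatial modulus of
continuity, both depending on `G` only through a sup bound.  The tree has them for ADAPTED
KERNELS (`kernelLimit_hasDerivAt_pairing`, `kernelLimit_pairing_lipschitz`,
`kernelLimit_space_modulus`); this file is the same for an arbitrary jointly smooth classical
solution on the open slab, for a general finite-dimensional inner product space `E`:

* `limit_hasDerivAt_pairing`: `d/dt ∫ ψ G(t) = ∫ G(t) (Dψ[b(t)] − ν Δψ)` (differentiation under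
  the integral on the compact support of `ψ`, the equation, integration by parts with
  `div b = 0`);
* `limit_pairing_lipschitz`: hence `|∫ψG(t) − ∫ψG(s)| ≤ L |t − s|` on `[t₁, t₂] ⊂ (tₘ, T)` with
  `L = ∫ Mb (A ‖Dψ‖ + ν |Δψ|)` when `|G| ≤ Mb` there and `‖b‖ ≤ A`;
* `limit_space_modulus`: `|G(t, y) − G(t, c)| ≤ ε` for `‖y − c‖ ≤ δ(ν, A, Mb, ρ, ε)` — the
  interior Lipschitz estimate `IsDriftHeatSolutionOn.abs_sub_le_lipConst` (Ishii–Lions) for the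
  reversed rescaled solution (`prekernel_bridge`).
-/

noncomputable section

open MeasureTheory Set Filter Topology Metric Function
open scoped Laplacian ContDiff RealInnerProductSpace
open Literature.Analysis.FluidPDE
open Summit.NavierStokesRegularity.NavierStokesRegularity.Theorems.AdaptedKernelExists.NashEntropyLastBlock

namespace Summit.NavierStokesRegularity.NavierStokesRegularity.Theorems.AdaptedFrequencyConverges.CloudFrameEffectiveTsai

section General

variable {E : Type*} [NormedAddCommGroup E] [InnerProductSpace ℝ E] [FiniteDimensional ℝ E]
  [MeasurableSpace E] [BorelSpace E]

/-- **Derivative of the pairing of a classical solution with a test function.**  For `G`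
jointly smooth on the open slab `Ioo tₘ T × E` with `∂ₜG + b·∇G + νΔG = 0` there (jointly smooth
divergence-free drift on `Ico tₘ T`) and a compactly supported `ψ ∈ C²`, at every `t ∈ Ioo tₘ T`:
`d/dt ∫ ψ G(t) = ∫ G(t) (Dψ[b(t)] − ν Δψ)`. -/
theorem limit_hasDerivAt_pairing {ν tₘ T : ℝ} {b : ℝ → E → E} {G : ℝ → E → ℝ}
    (hb : IsSmoothSpaceTimeOn (Ico tₘ T) b) (hdiv : ∀ t ∈ Ico tₘ T, VectorCalculus.IsDivFree (b t))
    (hG : IsSmoothSpaceTimeOn (Ioo tₘ T) G)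
    (heq : ∀ t ∈ Ioo tₘ T, ∀ x,
      deriv (fun s => G s x) t + fderiv ℝ (G t) x (b t x) + ν * (Δ (G t)) x = 0)
    {ψ : E → ℝ} (hψ : ContDiff ℝ 2 ψ) (hψc : HasCompactSupport ψ) {t : ℝ} (ht : t ∈ Ioo tₘ T) :
    HasDerivAt (fun s => ∫ x, ψ x * G s x)
      (∫ x, G t x * (fderiv ℝ ψ x (b t x) - ν * (Δ ψ) x)) t := by
  have hIco : Ioo tₘ T ⊆ Ico tₘ T := Ioo_subset_Ico_self
  have hO : IsOpen (Ioo tₘ T ×ˢ (univ : Set E)) := isOpen_Ioo.prod isOpen_univ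
  have hG2 : ContDiffOn ℝ 2 (uncurry G) (Ioo tₘ T ×ˢ univ) := hG.of_le (by norm_cast)
  have hDc : ContinuousOn (fun p : ℝ × E => fderiv ℝ (uncurry G) p) (Ioo tₘ T ×ˢ univ) :=
    hG2.continuousOn_fderiv_of_isOpen hO (by norm_num)
  have hD : ∀ s ∈ Ioo tₘ T, ∀ x, HasFDerivAt (uncurry G) (fderiv ℝ (uncurry G) (s, x)) (s, x) :=
    fun s hs x => ((hG2.differentiableOn (by norm_num)).differentiableAt
      (hO.mem_nhds ⟨hs, mem_univ x⟩)).hasFDerivAt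
  have hslice : ∀ s ∈ Ioo tₘ T, ContDiff ℝ 2 (G s) := fun s hs => prekernel_contDiff_slice hG hs
  -- a compact time interval around `t` inside the slab
  obtain ⟨ε, hε, hεI⟩ : ∃ ε : ℝ, 0 < ε ∧ Icc (t - ε) (t + ε) ⊆ Ioo tₘ T := by
    have hm : 0 < min (t - tₘ) (T - t) := lt_min (sub_pos.2 ht.1) (sub_pos.2 ht.2)
    refine ⟨min (t - tₘ) (T - t) / 2, by positivity, fun s hs => ⟨?_, ?_⟩⟩
    · have h1 : min (t - tₘ) (T - t) ≤ t - tₘ := min_le_left _ _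
      linarith [hs.1]
    · have h1 : min (t - tₘ) (T - t) ≤ T - t := min_le_right _ _
      linarith [hs.2]
  have hball : ball t ε ⊆ Icc (t - ε) (t + ε) := fun s hs => by
    rw [mem_ball, Real.dist_eq, abs_lt] at hs
    exact ⟨by linarith, by linarith⟩
  -- a bound for the time derivative on `[t − ε, t + ε] × tsupport ψ`
  have hDc1 : ContinuousOn (fun p : ℝ × E => fderiv ℝ (uncurry G) p (1, 0)) (Ioo tₘ T ×ˢ univ) :=
    hDc.clm_apply continuousOn_const
  obtain ⟨M, hM0, hM⟩ : ∃ M : ℝ, 0 ≤ M ∧ ∀ p ∈ Icc (t - ε) (t + ε) ×ˢ tsupport ψ,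
      ‖fderiv ℝ (uncurry G) p (1, 0)‖ ≤ M := by
    have hK : IsCompact (Icc (t - ε) (t + ε) ×ˢ tsupport ψ) := isCompact_Icc.prod hψc
    obtain ⟨M, hM⟩ := hK.exists_bound_of_continuousOn (hDc1.mono (prod_mono hεI (subset_univ _)))
    exact ⟨max M 0, le_max_right _ _, fun p hp => (hM p hp).trans (le_max_left _ _)⟩
  -- the derivative under the integral sign
  have hψ0 : ∀ x ∉ tsupport ψ, ψ x = 0 := fun x hx => image_eq_zero_of_notMem_tsupport hx
  have key := hasDerivAt_integral_of_dominated_loc_of_deriv_le (μ := (volume : Measure E))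
    (F := fun s x => ψ x * G s x) (F' := fun s x => ψ x * fderiv ℝ (uncurry G) (s, x) (1, 0))
    (x₀ := t) (bound := fun x => |ψ x| * M) (ball_mem_nhds t hε) ?_ ?_ ?_ ?_ ?_ ?_
  · -- identify the derivative
    have hform : ∫ x, ψ x * fderiv ℝ (uncurry G) (t, x) (1, 0) =
        ∫ x, G t x * (fderiv ℝ ψ x (b t x) - ν * (Δ ψ) x) := by
      have htI : t ∈ Ico tₘ T := hIco ht
      -- the equation at the interior time `t`
      have hadj : ∀ x, fderiv ℝ (uncurry G) (t, x) (1, 0) =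
          -(fderiv ℝ (G t) x (b t x)) - ν * (Δ (G t)) x := by
        intro x
        have he := heq t ht x
        rw [(hasDerivAt_timeLine (hD t ht x)).deriv] at he
        linarith
      simp_rw [hadj]
      have hGt : ContDiff ℝ 2 (G t) := hslice t ht
      have hbt : ContDiff ℝ 1 (b t) := (hb.contDiff_slice htI).of_le (by norm_cast)
      have e1 : ∫ x, ψ x * fderiv ℝ (G t) x (b t x) = -∫ x, G t x * fderiv ℝ ψ x (b t x) :=
        kernelLimit_integral_mul_fderiv_apply (hGt.of_le one_le_two) (hψ.of_le one_le_two) hψc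
          hbt (hdiv t htI)
      have e2 : ∫ x, ψ x * (Δ (G t)) x = ∫ x, G t x * (Δ ψ) x := by
        rw [Literature.Analysis.PDE.Rellich.integral_mul_laplacian_eq hGt hψ hψc]
        exact integral_congr_ae (Eventually.of_forall fun x => mul_comm _ _)
      -- integrability of the pieces (continuous with compact support)
      have hcψ : Continuous ψ := hψ.continuous
      have hcG : Continuous (G t) := hGt.continuous
      have hcDG : Continuous fun x => fderiv ℝ (G t) x (b t x) :=
        (hGt.continuous_fderiv (by norm_num)).clm_apply hbt.continuous
      have hcΔG : Continuous (Δ (G t)) := continuous_laplacian hGt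
      have hcDψ : Continuous fun x => fderiv ℝ ψ x (b t x) :=
        (hψ.continuous_fderiv (by norm_num)).clm_apply hbt.continuous
      have hcΔψ : Continuous (Δ ψ) := continuous_laplacian hψ
      have hi1 : Integrable fun x => ψ x * fderiv ℝ (G t) x (b t x) :=
        (hcψ.mul hcDG).integrable_of_hasCompactSupport hψc.mul_right
      have hi2 : Integrable fun x => ψ x * (ν * (Δ (G t)) x) :=
        (hcψ.mul (continuous_const.mul hcΔG)).integrable_of_hasCompactSupport hψc.mul_right
      have hsuppD : HasCompactSupport fun x => G t x * fderiv ℝ ψ x (b t x) := by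
        refine (hψc.fderiv (𝕜 := ℝ)).mono fun x hx => ?_
        rw [mem_support] at hx ⊢
        contrapose! hx
        simp [hx]
      have hsuppΔ : HasCompactSupport fun x => G t x * (ν * (Δ ψ) x) := by
        refine hψc.mono' ?_
        intro x hx
        rw [mem_support] at hx
        contrapose! hx
        simp [laplacian_eq_zero_of_notMem_tsupport hx]
      have hi3 : Integrable fun x => G t x * fderiv ℝ ψ x (b t x) :=
        (hcG.mul hcDψ).integrable_of_hasCompactSupport hsuppD
      have hi4 : Integrable fun x => G t x * (ν * (Δ ψ) x) :=
        (hcG.mul (continuous_const.mul hcΔψ)).integrable_of_hasCompactSupport hsuppΔ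
      have e3 : ∫ x, ψ x * (ν * (Δ (G t)) x) = ∫ x, G t x * (ν * (Δ ψ) x) := by
        calc ∫ x, ψ x * (ν * (Δ (G t)) x) = ν * ∫ x, ψ x * (Δ (G t)) x := by
              rw [← integral_const_mul]
              exact integral_congr_ae (Eventually.of_forall fun x => by ring)
          _ = ν * ∫ x, G t x * (Δ ψ) x := by rw [e2]
          _ = ∫ x, G t x * (ν * (Δ ψ) x) := by
              rw [← integral_const_mul]
              exact integral_congr_ae (Eventually.of_forall fun x => by ring)
      calc ∫ x, ψ x * (-(fderiv ℝ (G t) x (b t x)) - ν * (Δ (G t)) x)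
          = ∫ x, (-(ψ x * fderiv ℝ (G t) x (b t x)) - ψ x * (ν * (Δ (G t)) x)) :=
            integral_congr_ae (Eventually.of_forall fun x => by ring)
        _ = -(∫ x, ψ x * fderiv ℝ (G t) x (b t x)) - ∫ x, ψ x * (ν * (Δ (G t)) x) := by
            rw [integral_sub (f := fun x => -(ψ x * fderiv ℝ (G t) x (b t x))) hi1.neg hi2,
              integral_neg]
        _ = (∫ x, G t x * fderiv ℝ ψ x (b t x)) - ∫ x, G t x * (ν * (Δ ψ) x) := by
            rw [e1, neg_neg, e3]
        _ = ∫ x, G t x * (fderiv ℝ ψ x (b t x) - ν * (Δ ψ) x) := by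
            rw [← integral_sub hi3 hi4]
            exact integral_congr_ae (Eventually.of_forall fun x => by ring)
    rw [← hform]
    exact key.2
  · -- measurability of `F s` near `t`
    filter_upwards [ball_mem_nhds t hε] with s hs
    have hsO : s ∈ Ioo tₘ T := hεI (hball hs)
    exact (hψ.continuous.mul (hslice s hsO).continuous).aestronglyMeasurable
  · -- integrability of `F t`
    exact (hψ.continuous.mul (hslice t ht).continuous).integrable_of_hasCompactSupport
      hψc.mul_right
  · -- measurability of `F' t`
    have hc : Continuous fun x => fderiv ℝ (uncurry G) (t, x) (1, 0) := by
      have h1 : ContinuousOn (fun x : E => fderiv ℝ (uncurry G) (t, x) (1, 0)) univ :=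
        hDc1.comp (continuous_const.prodMk continuous_id).continuousOn
          (fun x _ => ⟨ht, mem_univ x⟩)
      exact continuousOn_univ.1 h1
    exact (hψ.continuous.mul hc).aestronglyMeasurable
  · -- the domination `‖F' s x‖ ≤ |ψ x| M` on the ball
    refine Eventually.of_forall fun x s hs => ?_
    by_cases hx : x ∈ tsupport ψ
    · have hp : (s, x) ∈ Icc (t - ε) (t + ε) ×ˢ tsupport ψ := ⟨hball hs, hx⟩
      rw [norm_mul, Real.norm_eq_abs]
      exact mul_le_mul_of_nonneg_left (hM _ hp) (abs_nonneg _)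
    · rw [hψ0 x hx]
      simp
  · -- integrability of the bound
    exact (continuous_abs.comp hψ.continuous).integrable_of_hasCompactSupport
      (hψc.norm.mono (by intro x; simp [Real.norm_eq_abs])) |>.mul_const M
  · -- pointwise derivative of `s ↦ ψ x G(s, x)` on the ball
    refine Eventually.of_forall fun x s hs => ?_
    have hsO : s ∈ Ioo tₘ T := hεI (hball hs)
    exact (hasDerivAt_timeLine (hD s hsO x)).const_mul (ψ x)

/-- **Equicontinuity in time of the pairings.**  In the situation of `limit_hasDerivAt_pairing`,
on a compact interval `[t₁, t₂] ⊂ (tₘ, T)` on which `‖b‖ ≤ A` and `|G| ≤ Mb` (`Mb, ν ≥ 0`),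
for a compactly supported `ψ ∈ C²`:
`|∫ψG(t) − ∫ψG(s)| ≤ L |t − s|` with `L = ∫ Mb (A ‖Dψ‖ + ν |Δψ|)` — a constant depending on
`G` only through `Mb`. -/
theorem limit_pairing_lipschitz {ν tₘ T t₁ t₂ A Mb : ℝ} {b : ℝ → E → E} {G : ℝ → E → ℝ}
    (hν : 0 ≤ ν) (hb : IsSmoothSpaceTimeOn (Ico tₘ T) b)
    (hdiv : ∀ t ∈ Ico tₘ T, VectorCalculus.IsDivFree (b t))
    (hG : IsSmoothSpaceTimeOn (Ioo tₘ T) G)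
    (heq : ∀ t ∈ Ioo tₘ T, ∀ x,
      deriv (fun s => G s x) t + fderiv ℝ (G t) x (b t x) + ν * (Δ (G t)) x = 0)
    {ψ : E → ℝ} (hψ : ContDiff ℝ 2 ψ) (hψc : HasCompactSupport ψ) (h₁ : tₘ < t₁) (h₂ : t₂ < T)
    (hbA : ∀ s ∈ Icc t₁ t₂, ∀ x, ‖b s x‖ ≤ A) (hMb : 0 ≤ Mb)
    (hGM : ∀ s ∈ Icc t₁ t₂, ∀ x, |G s x| ≤ Mb) {s t : ℝ} (hs : s ∈ Icc t₁ t₂)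
    (ht : t ∈ Icc t₁ t₂) :
    |(∫ x, ψ x * G t x) - ∫ x, ψ x * G s x| ≤
      (∫ x, Mb * (A * ‖fderiv ℝ ψ x‖ + ν * |(Δ ψ) x|)) * |t - s| := by
  have hsub : Icc t₁ t₂ ⊆ Ioo tₘ T := fun r hr => ⟨h₁.trans_le hr.1, hr.2.trans_lt h₂⟩
  -- the integrable bound
  have hcD : Continuous fun x => ‖fderiv ℝ ψ x‖ := (hψ.continuous_fderiv (by norm_num)).norm
  have hcΔ : Continuous fun x => |(Δ ψ) x| := continuous_abs.comp (continuous_laplacian hψ)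
  have hbc : Continuous fun x => Mb * (A * ‖fderiv ℝ ψ x‖ + ν * |(Δ ψ) x|) :=
    continuous_const.mul ((continuous_const.mul hcD).add (continuous_const.mul hcΔ))
  have hbsupp : HasCompactSupport fun x => Mb * (A * ‖fderiv ℝ ψ x‖ + ν * |(Δ ψ) x|) := by
    refine hψc.mono' fun x hx => ?_
    rw [mem_support] at hx
    contrapose! hx
    simp [fderiv_of_notMem_tsupport ℝ hx, laplacian_eq_zero_of_notMem_tsupport hx]
  have hbi : Integrable fun x => Mb * (A * ‖fderiv ℝ ψ x‖ + ν * |(Δ ψ) x|) :=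
    hbc.integrable_of_hasCompactSupport hbsupp
  -- the derivative bound at every time of the interval
  have hder : ∀ r ∈ Icc t₁ t₂, ‖∫ x, G r x * (fderiv ℝ ψ x (b r x) - ν * (Δ ψ) x)‖ ≤
      ∫ x, Mb * (A * ‖fderiv ℝ ψ x‖ + ν * |(Δ ψ) x|) := by
    intro r hr
    refine norm_integral_le_of_norm_le hbi (Eventually.of_forall fun x => ?_)
    rw [norm_mul, Real.norm_eq_abs]
    have h1 : |fderiv ℝ ψ x (b r x)| ≤ A * ‖fderiv ℝ ψ x‖ := by
      calc |fderiv ℝ ψ x (b r x)| = ‖fderiv ℝ ψ x (b r x)‖ := (Real.norm_eq_abs _).symm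
        _ ≤ ‖fderiv ℝ ψ x‖ * ‖b r x‖ := ContinuousLinearMap.le_opNorm _ _
        _ ≤ ‖fderiv ℝ ψ x‖ * A := mul_le_mul_of_nonneg_left (hbA r hr x) (norm_nonneg _)
        _ = A * ‖fderiv ℝ ψ x‖ := mul_comm _ _
    have h2 : |ν * (Δ ψ) x| = ν * |(Δ ψ) x| := by rw [abs_mul, abs_of_nonneg hν]
    have h3 : ‖fderiv ℝ ψ x (b r x) - ν * (Δ ψ) x‖ ≤ A * ‖fderiv ℝ ψ x‖ + ν * |(Δ ψ) x| := by
      rw [Real.norm_eq_abs]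
      exact (abs_sub _ _).trans (by rw [h2]; exact add_le_add h1 le_rfl)
    exact mul_le_mul (hGM r hr x) h3 (norm_nonneg _) hMb
  have key := Convex.norm_image_sub_le_of_norm_hasDerivWithin_le
    (f := fun r => ∫ x, ψ x * G r x)
    (f' := fun r => ∫ x, G r x * (fderiv ℝ ψ x (b r x) - ν * (Δ ψ) x))
    (fun r hr => (limit_hasDerivAt_pairing hb hdiv hG heq hψ hψc (hsub hr)).hasDerivWithinAt)
    hder (convex_Icc t₁ t₂) hs ht
  simpa only [Real.norm_eq_abs] using key

/-- **Spatial modulus of continuity, uniform in the solution.**  For `G` jointly smooth on the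
open slab `Ioo tₘ T × E` with `∂ₜG + b·∇G + νΔG = 0` (`ν > 0`, `‖b‖ ≤ Bd` on `Ico tₘ T`), an
interior block `[t, t + τ] ⊂ (tₘ, T)` on which `|G| ≤ M` (`M > 0`), and `0 < ρ` with `ρ² ≤ ντ`:
for every `ε > 0`, centre `c` and `y` with
`‖y − c‖ ≤ min (lipRad (Bd/ν) ρ) (ε / (lipConst (Bd/ν) ρ n · M + 1))` one has
`|G(t, y) − G(t, c)| ≤ ε` (the interior Lipschitz estimate for the reversed rescaled solution). -/
theorem limit_space_modulus {ν tₘ T t τ Bd M ρ ε : ℝ} {b : ℝ → E → E} {G : ℝ → E → ℝ}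
    (hν : 0 < ν) (ht : tₘ < t) (hτ : 0 < τ) (htT : t + τ < T)
    (hb : IsSmoothSpaceTimeOn (Ico tₘ T) b) (hBd : ∀ s ∈ Ico tₘ T, ∀ x, ‖b s x‖ ≤ Bd)
    (hBd0 : 0 ≤ Bd) (hG : IsSmoothSpaceTimeOn (Ioo tₘ T) G)
    (heq : ∀ s ∈ Ioo tₘ T, ∀ x,
      deriv (fun r => G r x) s + fderiv ℝ (G s) x (b s x) + ν * (Δ (G s)) x = 0)
    (hM : 0 < M) (hGM : ∀ s ∈ Icc t (t + τ), ∀ x, |G s x| ≤ M) (hρ : 0 < ρ) (hρτ : ρ ^ 2 ≤ ν * τ)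
    (hε : 0 < ε) (c y : E)
    (hy : ‖y - c‖ ≤ min (lipRad (Bd / ν) ρ)
      (ε / (lipConst (Bd / ν) ρ (Module.finrank ℝ E) * M + 1))) :
    |G t y - G t c| ≤ ε := by
  -- the local class on the block `[t, t + τ]`
  obtain ⟨a, hv0⟩ := prekernel_bridge (t₁ := t + τ) hν (by linarith) htT hb hBd hG heq
  have hv : IsDriftHeatSolutionOn a (fun σ => G (t + τ - σ / ν)) (Bd / ν) (Icc 0 (ν * τ)) univ :=
    hv0.mono (fun σ hσ => ⟨hσ.1, hσ.2.trans_lt (mul_lt_mul_of_pos_left (by linarith) hν)⟩)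
      Subset.rfl
  have hS : Icc (ν * τ - ρ ^ 2) (ν * τ) ⊆ Icc 0 (ν * τ) := Icc_subset_Icc (by nlinarith) le_rfl
  have hbd : ∀ σ ∈ Icc (ν * τ - ρ ^ 2) (ν * τ), ∀ x ∈ closedBall c (2 * ρ),
      |G (t + τ - σ / ν) x| ≤ M := by
    intro σ hσ x _
    exact hGM _ (lowerOfUpper_clamp hν (hS hσ)).2 x
  have hA : 0 ≤ Bd / ν := div_nonneg hBd0 hν.le
  have hL : 0 < lipConst (Bd / ν) ρ (Module.finrank ℝ E) := lipConst_pos hA hρ (Nat.cast_nonneg _)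
  have hLM : 0 < lipConst (Bd / ν) ρ (Module.finrank ℝ E) * M + 1 := by positivity
  have key := hv.abs_sub_le_lipConst isOpen_univ (x₀ := c) (t₀ := ν * τ) hρ hM
    (subset_univ _) hS hbd
  have e1 : t + τ - ν * τ / ν = t := by field_simp; ring
  have h1 : |G t y - G t c| ≤ lipConst (Bd / ν) ρ (Module.finrank ℝ E) * M * ‖y - c‖ := by
    have := key y (mem_closedBall.2 (by rw [dist_eq_norm]; exact hy.trans (min_le_left _ _)))
    simpa only [e1] using this
  have h2 : ‖y - c‖ ≤ ε / (lipConst (Bd / ν) ρ (Module.finrank ℝ E) * M + 1) :=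
    hy.trans (min_le_right _ _)
  calc |G t y - G t c| ≤ lipConst (Bd / ν) ρ (Module.finrank ℝ E) * M * ‖y - c‖ := h1
    _ ≤ lipConst (Bd / ν) ρ (Module.finrank ℝ E) * M *
          (ε / (lipConst (Bd / ν) ρ (Module.finrank ℝ E) * M + 1)) :=
        mul_le_mul_of_nonneg_left h2 (by positivity)
    _ ≤ ε := by
        rw [mul_div_assoc', div_le_iff₀ hLM]
        nlinarith

end General

/-! ### Registered sub-goal (dimension three) -/

/-- **Registered sub-goal `stub_blockSolver_limitTools`** (the `ℝ³` form of `limit_space_modulus`,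
sub-goal of STUB `stub_blockSolver`): a spatial modulus of continuity for a classical solution of
the backward drift–heat equation at the bottom of an interior block, depending on the solution
only through a drift bound and a sup bound on the block. -/
theorem stub_blockSolver_limitTools :
    ∀ (ν tₘ T t τ Bd M ρ ε : ℝ) (b : ℝ → (EuclideanSpace ℝ (Fin 3)) → (EuclideanSpace ℝ (Fin 3))) (G : ℝ → (EuclideanSpace ℝ (Fin 3)) → ℝ) (c y : (EuclideanSpace ℝ (Fin 3))), 0 < ν → tₘ < t → 0 < τ → t + τ < T → IsSmoothSpaceTimeOn (Ico tₘ T) b → (∀ s ∈ Ico tₘ T, ∀ x, ‖b s x‖ ≤ Bd) → 0 ≤ Bd → IsSmoothSpaceTimeOn (Ioo tₘ T) G → (∀ s ∈ Ioo tₘ T, ∀ x, deriv (fun r => G r x) s + fderiv ℝ (G s) x (b s x) + ν * Laplacian.laplacian (G s) x = 0) → 0 < M → (∀ s ∈ Icc t (t + τ), ∀ x, |G s x| ≤ M) → 0 < ρ → ρ ^ 2 ≤ ν * τ → 0 < ε → ‖y - c‖ ≤ min (lipRad (Bd / ν) ρ) (ε / (lipConst (Bd / ν) ρ 3 * M + 1))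 → |G t y - G t c| ≤ ε := by
  intro ν tₘ T t τ Bd M ρ ε b G c y hν ht hτ htT hb hBd hBd0 hG heq hM hGM hρ hρτ hε hy
  have h := limit_space_modulus hν ht hτ htT hb hBd hBd0 hG heq hM hGM hρ hρτ hε c y
  simp only [finrank_euclideanSpace_fin, Nat.cast_ofNat] at h
  exact h hy

end Summit.NavierStokesRegularity.NavierStokesRegularity.Theorems.AdaptedFrequencyConverges.CloudFrameEffectiveTsai

end
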